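import Summits.ResolutionOfSingularities.ResolutionOfSingularities.Theorems.EquisingularLiftEquisingularLiftNatSubchainSupplierInvSLDefs
import Summits.ResolutionOfSingularities.ResolutionOfSingularities.Theorems.EquisingularLiftEquisingularLiftNatEmbeddedCurveLiftOfFact
import HarnessLib

/-!
# [OURS · L1 W4.5(b) · EL♮(3) · WIDTH TABLE D5 «IMMATURE HOST», brick D5-3 (PROMOTE plumbing)] A PRE-LETTER WITH REGULAR TRACE IS A LETTER

res-L1-w45b-stub-2 g15 (desk D5 deal 2026-08-28T20:28:50Z: «D5-3 stub-2 = the PROMOTE move's HSUB plumbing»; idea-1 ROUND 17 Δ3; this seat's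
bus signature 2026-08-28T20:3xZ).  OURS; NOT a statement of any manuscript ([Hironaka2017] is a candidate under adjudication, nothing of it is asserted);
AI-written, weaker than expert review.  No `sorry`; standard axioms; DEF-FREE (the four pre-letter clauses are taken UNFOLDED, so the lemma lands before
res-type-027's `PreLetterDatumWith` Defs and is applied after `obtain ⟨h1, h2, h4, h5⟩`).  `--supports stmt-ResolutionOfSingularities-20148 --as helper`.

WHAT.  `TCPlus.letterDatum_of_clauses_of_isRegular_redSub`: at a stage `σ : X ⟶ P` over `q : P ⟶ Spec O` (`σ ≫ q` proper) with model square
`jG : G ⟶ X` over `Spec θ` (`θ : O → k` surjective, `k` algebraically closed), an ideal sheaf `𝓛` with the four PRE-LETTER clauses of res-type-027's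
`TCPlus.LetterDatum` — (l-i) reduced trace `𝓛·𝒪_G = 𝓘⟨closure L⟩`, (l-ii) stalkwise principal, (l-iv) `σ(supp 𝓛)` off the generic point of `Y`,
(l-v) `V(𝓛) → Spec O` flat — whose DOWNSTAIRS trace `(closure L)~ = 𝓘⟨closure L⟩.subscheme` (= `redSub G (closure L) _`, stated unfolded to stay cone-free) is a REGULAR scheme, IS a letter: (l-iii) `V(𝓛)` regular.
This is the upstairs half of the PROMOTION move (iii) of WIDTH TABLE D5 (an immature host `M` becomes a host once `St^k M` is regular), in the form the
HSUB re-assembly consumes (downstairs certificate in, `TCPlus.LetterDatum` out).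

PROOF.  The special fibre of `V(𝓛) → Spec O` is `(𝓛·𝒪_G).subscheme` (the model square of `V(𝓛)` over `Spec θ`: Mathlib's
`isPullback_of_isClosedImmersion` pasted onto `hsq`, as in res-L1-w45b-stub-4's ✓ `TCPlus.hostedPointStep_of_letterDatum_local`), which is
`redSub G (closure L)` by (l-i); then res-type-027's ✓ P4 `isRegular_of_flat_proper_of_isRegular_specialFibre` (proper flat over a DVR with regular
special fibre over `k = k̄` ⇒ regular; EGA IV 17.5.8 route). [folklore; pure composition]
-/

set_option linter.dupNamespace false -- mandated namespace `Summit.<Summit>.<Problem>` of this single-conjunct summit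
set_option linter.overlappingInstances false -- signatures carry `[IsDomain O] [IsDiscreteValuationRing O]`

noncomputable section

open CategoryTheory CategoryTheory.Limits AlgebraicGeometry TopologicalSpace Topology IsLocalRing
open Literature.AlgebraicGeometry.Resolution
open AlgebraicGeometry.Scheme.IdealSheafData
open Summit.ResolutionOfSingularities.ResolutionOfSingularities.Theses.EquisingularLift.Split
open Summit.ResolutionOfSingularities.ResolutionOfSingularities.Cruxes.EquisingularLift.StrataSplit

namespace Summit.ResolutionOfSingularities.ResolutionOfSingularities.Cruxes.EquisingularLiftNat.Sections

/-- **PROMOTION: a pre-letter whose reduced trace is a regular scheme is a letter.**  See the module docstring. [folklore; pure composition of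
Mathlib's `isPullback_of_isClosedImmersion` and ✓ `isRegular_of_flat_proper_of_isRegular_specialFibre`] [OURS · L1 W4.5b · WIDTH TABLE D5 brick D5-3] -/
theorem TCPlus.letterDatum_of_clauses_of_isRegular_redSub (O : Type) [CommRing O] [IsDomain O] [IsDiscreteValuationRing O]
    (k : Type) [Field k] [IsAlgClosed k] (θ : O →+* k) (hθ : Function.Surjective θ)
    {P X G : Scheme.{0}} (q : P ⟶ Spec (.of O)) (Y : Set P) (σ : X ⟶ P) [IsProper (σ ≫ q)]
    (jG : G ⟶ X) (tG : G ⟶ Spec (.of k)) (hsq : IsPullback jG tG (σ ≫ q) (Spec.map (CommRingCat.ofHom θ)))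
    {L : Set G} (𝓛 : X.IdealSheafData)
    (h1 : 𝓛.comap jG = vanishingIdeal (⟨closure L, isClosed_closure⟩ : Closeds G))
    (h2 : ∀ z : X, (stalkIdeal 𝓛 z).IsPrincipal)
    (h4 : σ '' (𝓛.support : Set X) ⊆ {p : P | ¬ IsGenericPoint p Y})
    (h5 : Flat (𝓛.subschemeι ≫ σ ≫ q))
    (hreg : Scheme.IsRegular (vanishingIdeal (⟨closure L, isClosed_closure⟩ : Closeds G)).subscheme) :
    TCPlus.LetterDatum O P q Y G X σ jG L := by
  refine ⟨𝓛, h1, h2, ?_, h4, h5⟩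
  -- the model square of `W = V(𝓛)` over `Spec θ`
  let ιW := 𝓛.subschemeι
  let iX := (𝓛.comap jG).subschemeι
  let jW : (𝓛.comap jG).subscheme ⟶ 𝓛.subscheme :=
    Scheme.IdealSheafData.subschemeMap (𝓛.comap jG) 𝓛 jG (𝓛.le_map_comap jG)
  have hjW : jW ≫ ιW = iX ≫ jG := Scheme.IdealSheafData.subschemeMap_subschemeι _ _ _ _
  have hsq1 : IsPullback iX jW jG ιW :=
    isPullback_of_isClosedImmersion iX ιW jW jG hjW.symm
      (by rw [Scheme.IdealSheafData.ker_subschemeι, Scheme.IdealSheafData.ker_subschemeι])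
  have hsqW : IsPullback jW (iX ≫ tG) (ιW ≫ σ ≫ q) (Spec.map (CommRingCat.ofHom θ)) := hsq1.flip.paste_vert hsq
  -- the special fibre `(𝓛·𝒪_G).subscheme` is the regular `𝓘⟨closure L⟩.subscheme` by (l-i)
  have hW₀ : Scheme.IsRegular (𝓛.comap jG).subscheme := by
    have key : ∀ I : G.IdealSheafData, I = vanishingIdeal (⟨closure L, isClosed_closure⟩ : Closeds G) →
        Scheme.IsRegular I.subscheme := by
      intro I hI; subst hI; exact hreg
    exact key _ h1
  -- P4: proper flat over `O` with regular special fibre ⇒ regular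
  haveI : Flat (ιW ≫ σ ≫ q) := h5
  haveI : IsProper (ιW ≫ σ ≫ q) := inferInstance
  exact isRegular_of_flat_proper_of_isRegular_specialFibre θ hθ (ιW ≫ σ ≫ q) jW (iX ≫ tG) hsqW hW₀

end Summit.ResolutionOfSingularities.ResolutionOfSingularities.Cruxes.EquisingularLiftNat.Sections

end
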